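import Summits.QuantumFields.YangMills.Theorems.BalabanUVNodesN27KeyedKnitWorldFree

/-!
# BalabanUVNodes ∕ N27 = binder B5 AT THE RECORD, XXIVc — THE KEYED KNIT WITH THE RATES CURRENCY FACTORED OUT («keyed core»; stage-generic, abstract key)
# (plan g77 YMPLAN-G77-N16-PICK (B)(e2), I.23344: «N16 currency of record = R-β `S_N16Holder β` … the ₁₃ composer twin — dag-n27-c's pen»; director-ym №195 (4))

Cell `pub-ymgap`, HUMAN RULING D-0062 Track A, R134 seat `pub-ymgap-dag-n27-c` (s2) gen 10; K3⁷ `SpineGivenEndpointR13SepCoPH` = stmt-QuantumFields-20544, `--kind proof --supports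
20544 --as helper`; COUNT-NEUTRAL; THEOREMS ONLY, 0 `def`, 0 `sorry`; `N`-generic, stage-generic, restate- and re-pin-immune: imports XXIVb `…N27KeyedKnitWorldFree` only (XXIV, XII
underneath).  Companion of XXIV `spine_of_keyedFaces` ∕ XXIVb `forall_guarded_of_keyedFaces` (same abstract key `(Θ, Hp, Adm, datumOf)`, same readings `cr` ∕ `rr`); the Stage-13
`CoPH` instances and the plan's R-β instance reading dag-n16-c's `N16HolderAt … β` are the sequel `…N27AtRecord13CoPHKeyedCore`.

THE OBSERVATION (kernel, XXIV `spine_of_keyedFaces`'s own proof): in the keyed composer the K4 rates `RatesAt (datumOf θ h) (rr θ h g₀ os)` are a CUT FORMULA — produced by the face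
`hrates`, consumed only by the same-tuple N19′ edge `h19`, never read by B5's composition (XII `spine_of_coreEdge` at `Inputs := ⊤`).  Hence ONE composer serves EVERY rates currency
(β = 1 `RatesAt`; the plan's R-β Hölder letter; R-β″; any future pick): state it with the rates REMOVED («keyed core»: N20, N21, the UNCONDITIONAL same-tuple ∃δ-core edge = N19's
conclusion with its K4 in-edges fed in whatever currency, the keyed extraction clause ⇒ B5) and, equivalently, with an ARBITRARY rates predicate `P D R` in the `hrates` ∕ `h19` slots.
The β = 1 composers of record are the instance `P := RatesAt` (untouched).

WHAT IS KERNEL-CHECKED ([bookkeeping]; 0 `def`, 0 `sorry`; abstract key, `cr` ∕ `rr` ∕ `G` ∕ `P` PARAMETERS): `spine_of_keyedCore` ((K1) ⇒ `Spine Rec`) · `forall_keyed_of_keyedCore`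
(world-free keyed form) · `forall_guarded_of_keyedCore` (a guard threaded through) · `spine_of_keyedFacesP` · `forall_guarded_of_keyedFacesP` (any rates predicate `P`).

HONEST FRAMING.  COMPOSITE-node bookkeeping over hypothesis SHAPES; every face ∕ edge ∕ clause is a HYPOTHESIS (0∕1 at every record today); nothing of Bałaban's asserted or
instantiated; NE7 ∕ NE7b ∕ NE7c NOT PRINTED for d = 4 and NOT PROVED; NO node discharged; K3⁷ NOT claimed; route, skeleton and every β = 1 decl UNTOUCHED (additive file); counts
UNMOVED (typed 28∕28 · discharged 5∕27, A 5∕28); one finite four-torus programme at fixed `ε` — NOT ℝ⁴, NOT infinite volume, NOT OS, NOT a mass gap, NOT Clay.  No decl below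
carries a cite tag.
-/

set_option autoImplicit false

namespace Summit.QuantumFields.YangMills.Theorems.BalabanUVNodesN27SpineRecord

open Literature.MathematicalPhysics.QuantumFieldTheory.Balaban1983to89
open Literature.MathematicalPhysics.QuantumFieldTheory.Balaban1983to89.T4Continuum
open T4WeightBudget (RelWeightBound)
open T4IndicatorShell (ShellWeightBound)
open T4ContinuumYM4Torus (ForSmallCouplings)
open Summit.QuantumFields.BalabanUV.T4Continuum.Spine
open YMDAG.UVSplit

universe u

variable {N : ℕ} [NeZero N]

/-! ## B5 from N20, N21, the UNCONDITIONAL same-tuple core edge and the keyed extraction clause at an abstract key; any rates predicate `P` -/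


section Abstract

variable {Θ : T4Family → Type u} (Hp : ∀ {F : T4Family}, Θ F → Prop) (Adm : ∀ {F : T4Family}, Θ F → Prop)
  (datumOf : ∀ {F : T4Family} (θ : Θ F), Hp θ → Datum F N) (Rec : RecordPred N)
  (cr : ∀ {F : T4Family} (θ : Θ F), Hp θ → (ℕ → ℝ) → List (ULoop F) → SpineCarriers)
  (rr : ∀ {F : T4Family} (θ : Θ F), Hp θ → (ℕ → ℝ) → List (ULoop F) → RateCarriers N)

/-- **N27 = B5 AT A KEYED RECORD FROM THE «KEYED CORE»** ((K1); XXIV `spine_of_keyedFaces` with the rates cut formula removed): if for EVERY admissible keyed θ, every `g₀`, `os` —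
N20 `RelWeightBound` and N21 `ShellWeightBound` at `cr θ h g₀ os`, the UNCONDITIONAL same-tuple ∃δ-core edge (SOME summable `δ` carrying `Spine.NE7.Core` on the shell-free cores of
`cr θ h g₀ os` — N19's conclusion with its K4 in-edges already fed in whatever currency), and the keyed extraction clause (`hx`) — THEN `Spine Rec` (XII `spine_of_coreEdge` at the inline
same-key predicate, `Inputs := ⊤`).  Every hypothesis 0∕1 today. [bookkeeping] -/
theorem spine_of_keyedCore
    (hK1 : ∀ (F : T4Family) (D : Datum F N) (w : DagBinding.WorldP), Rec F D w → ∃ (θ : Θ F) (h : Hp θ), Adm θ ∧ D = datumOf θ h)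
    (h20 : ∀ (F : T4Family) (θ : Θ F) (hP : Hp θ), Adm θ → ∀ (g₀ : ℕ → ℝ) (os : List (ULoop F)),
      RelWeightBound (cr θ hP g₀ os).l₀ (cr θ hP g₀ os).T (cr θ hP g₀ os).A (cr θ hP g₀ os).B (cr θ hP g₀ os).Bad (cr θ hP g₀ os).W)
    (h21 : ∀ (F : T4Family) (θ : Θ F) (hP : Hp θ), Adm θ → ∀ (g₀ : ℕ → ℝ) (os : List (ULoop F)),
      ShellWeightBound (cr θ hP g₀ os).l₀ (cr θ hP g₀ os).T (cr θ hP g₀ os).A (cr θ hP g₀ os).B (cr θ hP g₀ os).shA (cr θ hP g₀ os).shB (cr θ hP g₀ os).Wsh)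
    (hcore : ∀ (F : T4Family) (θ : Θ F) (hP : Hp θ), Adm θ → ∀ (g₀ : ℕ → ℝ) (os : List (ULoop F)), letI := (cr θ hP g₀ os).dec
      ∃ δ : ℕ → ℝ, NE7.Core (cr θ hP g₀ os).l₀ (cr θ hP g₀ os).vol (cr θ hP g₀ os).T (cr θ hP g₀ os).Bad
        (fun K t τ => (cr θ hP g₀ os).A K t τ - (cr θ hP g₀ os).shA K t τ) (fun K t τ => (cr θ hP g₀ os).B K t τ - (cr θ hP g₀ os).shB K t τ) δ ∧ Summable δ)
    (hx : ∀ (F : T4Family) (θ : Θ F) (hP : Hp θ), Adm θ →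
      B16.EndStatementBPrinted (datumOf θ hP).C → DagBinding.EndpointExistence (datumOf θ hP).C.toB12 →
        ForSmallCouplings (datumOf θ hP) fun g₀ => ∀ os : List (ULoop F),
          0 < (cr θ hP g₀ os).l₀ ∧ 0 < (cr θ hP g₀ os).vol ∧
          (∀ (K : ℕ) (t : ℝ), |t| ≤ (cr θ hP g₀ os).l₀ →
            T4GenFunBounds.schemeZ ((datumOf θ hP).scheme g₀) os ((cr θ hP g₀ os).K₀ + K) t = ∑ τ ∈ (cr θ hP g₀ os).T K, (cr θ hP g₀ os).A K t τ) ∧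
          (∀ (K : ℕ) (t : ℝ), |t| ≤ (cr θ hP g₀ os).l₀ →
            T4GenFunBounds.schemeZ ((datumOf θ hP).scheme g₀) os ((cr θ hP g₀ os).K₀ + K + 1) t = ∑ τ ∈ (cr θ hP g₀ os).T K, (cr θ hP g₀ os).B K t τ)) :
    Spine Rec := by
  refine spine_of_coreEdge Rec
    (fun F D g₀ os S => ∃ (θ : Θ F) (hP : Hp θ), Adm θ ∧ D = datumOf θ hP ∧ S = cr θ hP g₀ os)
    (fun _ _ _ _ => True) ?_ ?_ ?_ ?_ fun _ _ _ _ _ _ => ForSmallCouplings.of_forall fun _ _ => trivial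
  · intro F D w hR hB hEnd
    obtain ⟨θ, hP, hθ, rfl⟩ := hK1 F D w hR
    refine (hx F θ hP hθ hB hEnd).mono fun g₀ hg os => ?_
    obtain ⟨hl₀, hvol, hZA, hZB⟩ := hg os
    exact ⟨cr θ hP g₀ os, ⟨θ, hP, hθ, rfl, rfl⟩, hl₀, hvol, hZA, hZB⟩
  · intro F D g₀ os S hS
    obtain ⟨θ, hP, hθ, -, rfl⟩ := hS
    exact h20 F θ hP hθ g₀ os
  · intro F D g₀ os S hS
    obtain ⟨θ, hP, hθ, -, rfl⟩ := hS
    exact h21 F θ hP hθ g₀ os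
  · intro F D g₀ os S hS _
    obtain ⟨θ, hP, hθ, -, rfl⟩ := hS
    exact hcore F θ hP hθ g₀ os

/-- **THE WORLD-FREE KEYED B5 FROM THE KEYED CORE** (§1 at the keyed-datum class, XXIVb `spine_keyedClass_iff_forall_keyed`): «∀ θ h, Adm θ → HybridNE7Under (datumOf θ h) END».
[bookkeeping] -/
theorem forall_keyed_of_keyedCore
    (h20 : ∀ (F : T4Family) (θ : Θ F) (hP : Hp θ), Adm θ → ∀ (g₀ : ℕ → ℝ) (os : List (ULoop F)),
      RelWeightBound (cr θ hP g₀ os).l₀ (cr θ hP g₀ os).T (cr θ hP g₀ os).A (cr θ hP g₀ os).B (cr θ hP g₀ os).Bad (cr θ hP g₀ os).W)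
    (h21 : ∀ (F : T4Family) (θ : Θ F) (hP : Hp θ), Adm θ → ∀ (g₀ : ℕ → ℝ) (os : List (ULoop F)),
      ShellWeightBound (cr θ hP g₀ os).l₀ (cr θ hP g₀ os).T (cr θ hP g₀ os).A (cr θ hP g₀ os).B (cr θ hP g₀ os).shA (cr θ hP g₀ os).shB (cr θ hP g₀ os).Wsh)
    (hcore : ∀ (F : T4Family) (θ : Θ F) (hP : Hp θ), Adm θ → ∀ (g₀ : ℕ → ℝ) (os : List (ULoop F)), letI := (cr θ hP g₀ os).dec
      ∃ δ : ℕ → ℝ, NE7.Core (cr θ hP g₀ os).l₀ (cr θ hP g₀ os).vol (cr θ hP g₀ os).T (cr θ hP g₀ os).Bad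
        (fun K t τ => (cr θ hP g₀ os).A K t τ - (cr θ hP g₀ os).shA K t τ) (fun K t τ => (cr θ hP g₀ os).B K t τ - (cr θ hP g₀ os).shB K t τ) δ ∧ Summable δ)
    (hx : ∀ (F : T4Family) (θ : Θ F) (hP : Hp θ), Adm θ →
      B16.EndStatementBPrinted (datumOf θ hP).C → DagBinding.EndpointExistence (datumOf θ hP).C.toB12 →
        ForSmallCouplings (datumOf θ hP) fun g₀ => ∀ os : List (ULoop F),
          0 < (cr θ hP g₀ os).l₀ ∧ 0 < (cr θ hP g₀ os).vol ∧
          (∀ (K : ℕ) (t : ℝ), |t| ≤ (cr θ hP g₀ os).l₀ →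
            T4GenFunBounds.schemeZ ((datumOf θ hP).scheme g₀) os ((cr θ hP g₀ os).K₀ + K) t = ∑ τ ∈ (cr θ hP g₀ os).T K, (cr θ hP g₀ os).A K t τ) ∧
          (∀ (K : ℕ) (t : ℝ), |t| ≤ (cr θ hP g₀ os).l₀ →
            T4GenFunBounds.schemeZ ((datumOf θ hP).scheme g₀) os ((cr θ hP g₀ os).K₀ + K + 1) t = ∑ τ ∈ (cr θ hP g₀ os).T K, (cr θ hP g₀ os).B K t τ))
    (F : T4Family) (θ : Θ F) (hP : Hp θ) (hθ : Adm θ) :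
    T4ApexHybrid.HybridNE7Under (datumOf θ hP) (DagBinding.EndpointExistence (datumOf θ hP).C.toB12) :=
  (spine_keyedClass_iff_forall_keyed Hp Adm datumOf).mp (spine_of_keyedCore Hp Adm datumOf _ cr (fun _ _ _ hR => hR) h20 h21 hcore hx) F θ hP hθ

variable (G : ∀ {F : T4Family}, Θ F → Prop)

/-- **A GUARD THREADED THROUGH THE KEYED CORE** (§1 at the key `Adm' := G ∧ Adm`, curried; XXIVb `forall_guarded_of_keyedFaces`'s twin): «∀ θ h, G θ → Adm θ →
HybridNE7Under (datumOf θ h) END» from the four faces asked only of tuples with `G θ` and `Adm θ`. [bookkeeping] -/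
theorem forall_guarded_of_keyedCore
    (h20 : ∀ (F : T4Family) (θ : Θ F) (hP : Hp θ), G θ → Adm θ → ∀ (g₀ : ℕ → ℝ) (os : List (ULoop F)),
      RelWeightBound (cr θ hP g₀ os).l₀ (cr θ hP g₀ os).T (cr θ hP g₀ os).A (cr θ hP g₀ os).B (cr θ hP g₀ os).Bad (cr θ hP g₀ os).W)
    (h21 : ∀ (F : T4Family) (θ : Θ F) (hP : Hp θ), G θ → Adm θ → ∀ (g₀ : ℕ → ℝ) (os : List (ULoop F)),
      ShellWeightBound (cr θ hP g₀ os).l₀ (cr θ hP g₀ os).T (cr θ hP g₀ os).A (cr θ hP g₀ os).B (cr θ hP g₀ os).shA (cr θ hP g₀ os).shB (cr θ hP g₀ os).Wsh)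
    (hcore : ∀ (F : T4Family) (θ : Θ F) (hP : Hp θ), G θ → Adm θ → ∀ (g₀ : ℕ → ℝ) (os : List (ULoop F)), letI := (cr θ hP g₀ os).dec
      ∃ δ : ℕ → ℝ, NE7.Core (cr θ hP g₀ os).l₀ (cr θ hP g₀ os).vol (cr θ hP g₀ os).T (cr θ hP g₀ os).Bad
        (fun K t τ => (cr θ hP g₀ os).A K t τ - (cr θ hP g₀ os).shA K t τ) (fun K t τ => (cr θ hP g₀ os).B K t τ - (cr θ hP g₀ os).shB K t τ) δ ∧ Summable δ)
    (hx : ∀ (F : T4Family) (θ : Θ F) (hP : Hp θ), G θ → Adm θ →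
      B16.EndStatementBPrinted (datumOf θ hP).C → DagBinding.EndpointExistence (datumOf θ hP).C.toB12 →
        ForSmallCouplings (datumOf θ hP) fun g₀ => ∀ os : List (ULoop F),
          0 < (cr θ hP g₀ os).l₀ ∧ 0 < (cr θ hP g₀ os).vol ∧
          (∀ (K : ℕ) (t : ℝ), |t| ≤ (cr θ hP g₀ os).l₀ →
            T4GenFunBounds.schemeZ ((datumOf θ hP).scheme g₀) os ((cr θ hP g₀ os).K₀ + K) t = ∑ τ ∈ (cr θ hP g₀ os).T K, (cr θ hP g₀ os).A K t τ) ∧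
          (∀ (K : ℕ) (t : ℝ), |t| ≤ (cr θ hP g₀ os).l₀ →
            T4GenFunBounds.schemeZ ((datumOf θ hP).scheme g₀) os ((cr θ hP g₀ os).K₀ + K + 1) t = ∑ τ ∈ (cr θ hP g₀ os).T K, (cr θ hP g₀ os).B K t τ))
    (F : T4Family) (θ : Θ F) (hP : Hp θ) (hG : G θ) (hθ : Adm θ) :
    T4ApexHybrid.HybridNE7Under (datumOf θ hP) (DagBinding.EndpointExistence (datumOf θ hP).C.toB12) :=
  forall_keyed_of_keyedCore Hp (fun θ => G θ ∧ Adm θ) datumOf cr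
    (fun F θ hP hA => h20 F θ hP hA.1 hA.2) (fun F θ hP hA => h21 F θ hP hA.1 hA.2) (fun F θ hP hA => hcore F θ hP hA.1 hA.2)
    (fun F θ hP hA => hx F θ hP hA.1 hA.2) F θ hP ⟨hG, hθ⟩

variable (P : ∀ {F : T4Family}, Datum F N → RateCarriers N → Prop)

/-- **N27 = B5 AT A KEYED RECORD FROM THE KEYED FACES AT AN ARBITRARY RATES PREDICATE `P`** (§1 `spine_of_keyedCore` with `hcore := h19 ∘ hrates`): XXIV `spine_of_keyedFaces` is the
instance `P := RatesAt`; the plan's R-β currency is `P D R := RatesHolderAt D R β` (definer lane) ∕ §3's explicit six-conjunction. [bookkeeping] -/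
theorem spine_of_keyedFacesP
    (hK1 : ∀ (F : T4Family) (D : Datum F N) (w : DagBinding.WorldP), Rec F D w → ∃ (θ : Θ F) (h : Hp θ), Adm θ ∧ D = datumOf θ h)
    (h20 : ∀ (F : T4Family) (θ : Θ F) (hP : Hp θ), Adm θ → ∀ (g₀ : ℕ → ℝ) (os : List (ULoop F)),
      RelWeightBound (cr θ hP g₀ os).l₀ (cr θ hP g₀ os).T (cr θ hP g₀ os).A (cr θ hP g₀ os).B (cr θ hP g₀ os).Bad (cr θ hP g₀ os).W)
    (h21 : ∀ (F : T4Family) (θ : Θ F) (hP : Hp θ), Adm θ → ∀ (g₀ : ℕ → ℝ) (os : List (ULoop F)),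
      ShellWeightBound (cr θ hP g₀ os).l₀ (cr θ hP g₀ os).T (cr θ hP g₀ os).A (cr θ hP g₀ os).B (cr θ hP g₀ os).shA (cr θ hP g₀ os).shB (cr θ hP g₀ os).Wsh)
    (hrates : ∀ (F : T4Family) (θ : Θ F) (hP : Hp θ), Adm θ → ∀ (g₀ : ℕ → ℝ) (os : List (ULoop F)), P (datumOf θ hP) (rr θ hP g₀ os))
    (h19 : ∀ (F : T4Family) (θ : Θ F) (hP : Hp θ), Adm θ → ∀ (g₀ : ℕ → ℝ) (os : List (ULoop F)),
      P (datumOf θ hP) (rr θ hP g₀ os) → letI := (cr θ hP g₀ os).dec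
        ∃ δ : ℕ → ℝ, NE7.Core (cr θ hP g₀ os).l₀ (cr θ hP g₀ os).vol (cr θ hP g₀ os).T (cr θ hP g₀ os).Bad
          (fun K t τ => (cr θ hP g₀ os).A K t τ - (cr θ hP g₀ os).shA K t τ) (fun K t τ => (cr θ hP g₀ os).B K t τ - (cr θ hP g₀ os).shB K t τ) δ ∧ Summable δ)
    (hx : ∀ (F : T4Family) (θ : Θ F) (hP : Hp θ), Adm θ →
      B16.EndStatementBPrinted (datumOf θ hP).C → DagBinding.EndpointExistence (datumOf θ hP).C.toB12 →
        ForSmallCouplings (datumOf θ hP) fun g₀ => ∀ os : List (ULoop F),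
          0 < (cr θ hP g₀ os).l₀ ∧ 0 < (cr θ hP g₀ os).vol ∧
          (∀ (K : ℕ) (t : ℝ), |t| ≤ (cr θ hP g₀ os).l₀ →
            T4GenFunBounds.schemeZ ((datumOf θ hP).scheme g₀) os ((cr θ hP g₀ os).K₀ + K) t = ∑ τ ∈ (cr θ hP g₀ os).T K, (cr θ hP g₀ os).A K t τ) ∧
          (∀ (K : ℕ) (t : ℝ), |t| ≤ (cr θ hP g₀ os).l₀ →
            T4GenFunBounds.schemeZ ((datumOf θ hP).scheme g₀) os ((cr θ hP g₀ os).K₀ + K + 1) t = ∑ τ ∈ (cr θ hP g₀ os).T K, (cr θ hP g₀ os).B K t τ)) :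
    Spine Rec :=
  spine_of_keyedCore Hp Adm datumOf Rec cr hK1 h20 h21 (fun F θ hP hθ g₀ os => h19 F θ hP hθ g₀ os (hrates F θ hP hθ g₀ os)) hx

/-- **THE GUARDED WORLD-FREE KEYED B5 FROM THE KEYED FACES AT AN ARBITRARY RATES PREDICATE `P`** (XXIVb `forall_guarded_of_keyedFaces` is the instance `P := RatesAt`). [bookkeeping] -/
theorem forall_guarded_of_keyedFacesP
    (h20 : ∀ (F : T4Family) (θ : Θ F) (hP : Hp θ), G θ → Adm θ → ∀ (g₀ : ℕ → ℝ) (os : List (ULoop F)),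
      RelWeightBound (cr θ hP g₀ os).l₀ (cr θ hP g₀ os).T (cr θ hP g₀ os).A (cr θ hP g₀ os).B (cr θ hP g₀ os).Bad (cr θ hP g₀ os).W)
    (h21 : ∀ (F : T4Family) (θ : Θ F) (hP : Hp θ), G θ → Adm θ → ∀ (g₀ : ℕ → ℝ) (os : List (ULoop F)),
      ShellWeightBound (cr θ hP g₀ os).l₀ (cr θ hP g₀ os).T (cr θ hP g₀ os).A (cr θ hP g₀ os).B (cr θ hP g₀ os).shA (cr θ hP g₀ os).shB (cr θ hP g₀ os).Wsh)
    (hrates : ∀ (F : T4Family) (θ : Θ F) (hP : Hp θ), G θ → Adm θ → ∀ (g₀ : ℕ → ℝ) (os : List (ULoop F)), P (datumOf θ hP) (rr θ hP g₀ os))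
    (h19 : ∀ (F : T4Family) (θ : Θ F) (hP : Hp θ), G θ → Adm θ → ∀ (g₀ : ℕ → ℝ) (os : List (ULoop F)),
      P (datumOf θ hP) (rr θ hP g₀ os) → letI := (cr θ hP g₀ os).dec
        ∃ δ : ℕ → ℝ, NE7.Core (cr θ hP g₀ os).l₀ (cr θ hP g₀ os).vol (cr θ hP g₀ os).T (cr θ hP g₀ os).Bad
          (fun K t τ => (cr θ hP g₀ os).A K t τ - (cr θ hP g₀ os).shA K t τ) (fun K t τ => (cr θ hP g₀ os).B K t τ - (cr θ hP g₀ os).shB K t τ) δ ∧ Summable δ)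
    (hx : ∀ (F : T4Family) (θ : Θ F) (hP : Hp θ), G θ → Adm θ →
      B16.EndStatementBPrinted (datumOf θ hP).C → DagBinding.EndpointExistence (datumOf θ hP).C.toB12 →
        ForSmallCouplings (datumOf θ hP) fun g₀ => ∀ os : List (ULoop F),
          0 < (cr θ hP g₀ os).l₀ ∧ 0 < (cr θ hP g₀ os).vol ∧
          (∀ (K : ℕ) (t : ℝ), |t| ≤ (cr θ hP g₀ os).l₀ →
            T4GenFunBounds.schemeZ ((datumOf θ hP).scheme g₀) os ((cr θ hP g₀ os).K₀ + K) t = ∑ τ ∈ (cr θ hP g₀ os).T K, (cr θ hP g₀ os).A K t τ) ∧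
          (∀ (K : ℕ) (t : ℝ), |t| ≤ (cr θ hP g₀ os).l₀ →
            T4GenFunBounds.schemeZ ((datumOf θ hP).scheme g₀) os ((cr θ hP g₀ os).K₀ + K + 1) t = ∑ τ ∈ (cr θ hP g₀ os).T K, (cr θ hP g₀ os).B K t τ))
    (F : T4Family) (θ : Θ F) (hP : Hp θ) (hG : G θ) (hθ : Adm θ) :
    T4ApexHybrid.HybridNE7Under (datumOf θ hP) (DagBinding.EndpointExistence (datumOf θ hP).C.toB12) :=
  forall_guarded_of_keyedCore Hp Adm datumOf cr G h20 h21 (fun F θ hP hG' hθ' g₀ os => h19 F θ hP hG' hθ' g₀ os (hrates F θ hP hG' hθ' g₀ os)) hx F θ hP hG hθ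

end Abstract

end Summit.QuantumFields.YangMills.Theorems.BalabanUVNodesN27SpineRecord
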